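import Summits.QuantumFields.YangMills.Theorems.FlatTubeReductionFibreKernelReferenceMass
import Summits.QuantumFields.YangMills.Theorems.FlatTubeReductionFibreFactorReweighted
import HarnessLib

/-!
# The fibre factors of the `(C2)`-moments core bound are reference masses of the reweighted record profile

Support file for the crux `NearFlatRatioLaw` (line `ratepack_v2`, stub `stub_hODpot_A`, step (R3b-iv) of
`Cruxes/NearFlatRatioLaw/Lines/ratepack-v7-moments-g18.md` §10).

Composition of `…FibreFactorReweighted.fibre_factor_moment_le_reweighted` (colour removal, homogeneity, two-profile bound) and
`…FibreKernelReferenceMass.fpBOKernel_gaugeDev_le_reference_mass` (gauge-deviation weight → level weight → `RateTube.profile_moment_number`):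
for `β ≥ 900`, `βε² ≤ 1`, a profile `Ω` supported in the capped balanced set with `‖x̂‖ ≤ R ≤ 1`, an output weight `0 ≤ Ω₁ ≤ Ω` invariant
under the global colour rotation, exponents `a, k ≤ K`, `j ≤ 4`, and the two Gaussian profile-number inequalities for the reweighted profile
`Ω_K = Ω(1+β‖x‖²)^K` on a fibre core `C`:
`∫dπ Ω₁(v̂)‖v̂‖^{2a}·∫dc T[Ω‖·‖^{2k}, coreWeight·G^j](c⁻¹ oT(1,v) c; 1) ≤ β^{-(a+k+j)}·Ξ₁(A)·fpBOKernel β Ω_K (fpWeight ε) 1 1`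
(`fibre_factor_le_reference_mass`); the right side is a reference mass, bounded by profile numbers alone
(`RateTube.reference_mass_on_fibreSet_le`).
-/

noncomputable section

open MeasureTheory Filter Topology Real
open scoped BigOperators
open Literature.MathematicalPhysics.QuantumFieldTheory
open Literature.MathematicalPhysics.QuantumLattice

namespace Summit.QuantumFields.YangMills.Theorems.FemtoTransferGap.TwoLattice.ConstTube

open Summit.QuantumFields.YangMills.Theorems.FemtoTransferGap
open Summit.QuantumFields.YangMills.Theorems.FemtoTransferGap.TwoLattice
open Summit.QuantumFields.YangMills.Theorems.FemtoTransferGap.TwoLattice.Avg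
open Summit.QuantumFields.YangMills.Theorems.FemtoTransferGap.TwoLattice.Stiff (LinkSpace)

variable {L : ℕ} [NeZero L]

/-- ★★★ **THE FIBRE FACTORS ARE REFERENCE MASSES** (see the module docstring). [cite: Luscher1983, §3] -/
theorem fibre_factor_le_reference_mass {A : ℝ} (hA : 0 ≤ A) :
    ∃ Ξ₁ : ℝ, 0 ≤ Ξ₁ ∧ ∀ {β : ℝ}, 900 ≤ β → ∀ {Ω Ω₁ : LinkSpace L → ℝ}, Measurable Ω → Measurable Ω₁ → ∀ {CΩ : ℝ}, (∀ x, |Ω x| ≤ CΩ) → (∀ x, 0 ≤ Ω x) →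
      (∀ x, 0 ≤ Ω₁ x) → (∀ x, Ω₁ x ≤ Ω x) → (∀ (c : SU2) (x : LinkSpace L), Ω₁ (adL L c x) = Ω₁ x) → ∀ {R : ℝ}, R ≤ 1 →
      (∀ v : Edge 3 L → Fin 3 → ℝ, Ω (linkEmbed L v) ≠ 0 → v ∈ capBalancedSet L ∧ ‖linkEmbed L v‖ ≤ R) → ∀ {ε : ℝ}, 0 < ε → β * ε ^ 2 ≤ 1 →
      ∀ {K : ℕ} {C : Set (Edge 3 L → Fin 3 → ℝ)}, MeasurableSet C →
      (∀ v ∈ C, v ∈ capBalancedSet L ∧ ‖linkEmbed L v‖ ≤ (Real.sqrt β)⁻¹ ∧ ∀ (e : Edge 3 L) (c : Fin 3), |v e c| ≤ (Real.sqrt β)⁻¹) →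
      0 < ∫ v in C, Ω (linkEmbed L v) * (1 + β * ‖linkEmbed L v‖ ^ 2) ^ K ∂orthoTransverse L →
      ∫ v, Ω (linkEmbed L v) * (1 + β * ‖linkEmbed L v‖ ^ 2) ^ K * (1 + β * ‖linkEmbed L v‖ ^ 2) ^ 4 ∂orthoTransverse L ≤
        A * ∫ v in C, Ω (linkEmbed L v) * (1 + β * ‖linkEmbed L v‖ ^ 2) ^ K ∂orthoTransverse L →
      ∫ v, Ω (linkEmbed L v) * (1 + β * ‖linkEmbed L v‖ ^ 2) ^ K * (1 + β * ‖linkEmbed L v‖ ^ 2) ^ 4 * (Real.sqrt β * ‖linkEmbed L v‖) ^ (3 * Fintype.card {x : Site 3 L // ¬x = 0})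
          ∂orthoTransverse L ≤ A * ∫ v in C, Ω (linkEmbed L v) * (1 + β * ‖linkEmbed L v‖ ^ 2) ^ K ∂orthoTransverse L →
      ∀ (R₁ : ℝ) {a k j : ℕ}, a ≤ K → k ≤ K → j ≤ 4 →
      ∫ v, Ω₁ (linkEmbed L v) * (‖linkEmbed L v‖ ^ 2) ^ a *
          ∫ c, fpFibreTransfer L β (fun x => Ω x * (‖x‖ ^ 2) ^ k) (fun g => coreWeight L ε R₁ g * (∑ x, ‖su2Quat (g x) - 1‖ ^ 2) ^ j)
            (gaugeTransform (fun _ : Site 3 L => c⁻¹) (orthoTube L 1 v)) 1 ∂haarProbability SU2 ∂orthoTransverse L ≤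
        (β ^ (a + k + j))⁻¹ * Ξ₁ * fpBOKernel L β (fun x => Ω x * (1 + β * ‖x‖ ^ 2) ^ K) (fpWeight L ε) 1 1 := by
  obtain ⟨Ξ₁, hΞ₁, hRM⟩ := fpBOKernel_gaugeDev_le_reference_mass (L := L) hA
  refine ⟨Ξ₁, hΞ₁, ?_⟩
  intro β hβ Ω Ω₁ hΩm hΩ₁m CΩ hCΩ hΩ0 hΩ₁0 hΩ₁le hΩ₁inv R hR1 hΩt ε hε hβε K C hC hCsub hθ hn1 hn2 R₁ a k j haK hkK hj
  have hβp : (0 : ℝ) < β := by linarith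
  -- step 1: colour removal, homogeneity, two-profile bound
  have h1 := fibre_factor_moment_le_reweighted (L := L) hβp hΩm hΩ₁m hCΩ hΩ0 hΩ₁0 hΩ₁le hΩ₁inv hΩt (measurable_coreWeight (L := L) ε R₁)
    (abs_coreWeight_le (L := L) ε R₁) (fun g => (coreWeight_mem_Icc (L := L) ε R₁ g).1) haK hkK j
  -- step 2: the reweighted profile's data and the reference-mass bound
  obtain ⟨hΩKm, hΩK0, hΩKb, hΩKt⟩ := RateTube.reweight_props (L := L) hβp.le hΩm hCΩ hΩ0 hΩt K
  have h2 := hRM hβ hΩKm hΩKb hΩK0 hR1 hΩKt hε hβε hC hCsub hθ hn1 hn2 R₁ hj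
  have hpow : 0 ≤ (β ^ (a + k + j))⁻¹ := inv_nonneg.mpr (pow_nonneg hβp.le _)
  calc _ ≤ (β ^ (a + k + j))⁻¹ * fpBOKernel L β (fun x => Ω x * (1 + β * ‖x‖ ^ 2) ^ K) (fun g => coreWeight L ε R₁ g * (1 + β * ∑ x, ‖su2Quat (g x) - 1‖ ^ 2) ^ j) 1 1 := h1
    _ ≤ (β ^ (a + k + j))⁻¹ * (Ξ₁ * fpBOKernel L β (fun x => Ω x * (1 + β * ‖x‖ ^ 2) ^ K) (fpWeight L ε) 1 1) := mul_le_mul_of_nonneg_left h2 hpow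
    _ = (β ^ (a + k + j))⁻¹ * Ξ₁ * fpBOKernel L β (fun x => Ω x * (1 + β * ‖x‖ ^ 2) ^ K) (fpWeight L ε) 1 1 := by ring

end Summit.QuantumFields.YangMills.Theorems.FemtoTransferGap.TwoLattice.ConstTube

end
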